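import Summits.ABC.IUTFork.Cor312RegimeVerbatimPrVolExact
import HarnessLib

/-!
# [IUTchIII] Cor. 3.12 — abc-iut-c312-5's EXACT hull computation at the sharp setting of record, re-threaded on the ONE
# hypothesis it uses: the log-shell lattice of each summand IS the normalised packet (`hshell`)

PROOF-ONLY support piece of the abc-iut cell (Cor. 3.12 cone, D-0067; seat abc-iut-w4-d107, gen 5; part 21 of the
`Cor312NegLogThetaUpperPrVol*` / `Cor312RegimeVerbatimPrVol*` chain). TAKES NO SIDE on [IUTchIII] Cor. 3.12; theorems only,
0 `def`s, no new `Prop` fact, no instance.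

abc-iut-c312-5's chain `Cor312VolumesPadicLatticeScaledHull` (p429612) → `Cor312HullStableDHVol` → `Cor312HullVolumeDHVolScaled`
(p429931) → `Cor312HullVolumePrVolScaled` (p433308) computes, at an ODD prime `p ∤ disc(F)`, the holomorphic hull of the union
of ALL possible images of summand-wise `ℚ_p`-scaled boxes and its log-volume (`^{n,∘}𝒰_{i+1,p} = e⁻¹(Π_{v⃗} p^{min_a m(v_a)}·I_{v⃗})`,
`−|log(Θ)|_{i+1,p} = Σ_{v⃗} Pr(v⃗)·(−min_a m(v⃗ a)·log p)`). The hypotheses `p > 2`, `p ∤ disc(F)` enter ONLY through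
abc-iut-c312-3's `logShell_eq_normalizedPacket_of_unramified` (`I_{v⃗} = (R_{v⃗})^∼`). THIS FILE re-threads the chain on that
single hypothesis, stated per packet as
`hshell : ∀ e, logShell p ((presAt X hlog p).kk e) = (normalizedPacket p ((presAt X hlog p).kk e) : Set _)`,
so that it applies VERBATIM wherever the log-shell lattice is the normalised packet — in particular at the DYADIC packets of a
field in which `2` splits completely (`Literature.IUT.LogVolume.logShell_eq_normalizedPacket_of_dyadicSplit`, p450124; the
sequel `Cor312RegimeVerbatimPrVolExactDyadicSplit` draws `−|log(Θ)|(𝟙) = 0` over `ℚ` from it):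

* §1 lattice lemmas `latticePkS_eq_of_shell`, `latticePkS_eq_preimage_hullSet_of_shell`, `image_factorMap_latticePkS_of_shell`;
* §2 at `Real.settingDHVol` with summand-wise scaled boxes: `thetaRegion3_eq_latticePkS_of_shell`,
  `sUnion_possibleImages_eq_of_shell`, `image_sUnion_possibleImages_eq_of_shell`, `thetaHull_eq_latticePkS_of_shell`;
* §3 at the sharp settings of record with Θ-exponents `‖t_{Θ,i+1,v}‖ = ‖p^{m(v)}‖` over `p`:
  `thetaHull_settingDHVolSharp_eq_of_zpow_of_shell`, `thetaHull_settingPrVolSharp_eq_of_zpow_of_shell`,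
  `logvol_latticePkS_ppow_settingPrVol_of_shell`, **`thetaLocal_settingPrVolSharp_eq_of_zpow_of_shell`**
  (`−|log(Θ)|_{i+1,p} = Σ_{v⃗} Pr(v⃗)·(−min_a m(v⃗ a)·log p)` under `hshell`).
Every proof is abc-iut-c312-5's with the unramified-shell lemma replaced by the hypothesis (credit c312-5 / c312-3). HONEST
SCOPE: (Ind2) as typed (`Real.ismDH`); sharp (Ind3) reading; nothing here asserts or denies [IUTchIII] Cor. 3.12. typed ≠ proved.
[claim: Mochizuki2012, status: disputed] [cite: DupuyHilado2025, §3.6, §3.9, §4.7, §4.9] [cite: Mochizuki2012, IUTchIV Thm 1.10 proof Step (vi) p. 29]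
-/

noncomputable section

open Set Function NumberField IsDedekindDomain Bornology
open scoped Pointwise

namespace Summit.ABC.IUTFork

namespace Cor312Vol.PadicPresentation

open Thm311 Literature.IUT.LogThetaLattice Literature.IUT.LogVolume

variable {T : ThetaIndex} {L : LogShells T} {vQ : T.VQ} {p : ℕ} [hp : Fact p.Prime] (P : PadicPresentation L vQ p)
  {j : T.Label}

/-! ## §1. Scaled lattices are hull-set preimages whenever the log-shell lattice is the normalised packet -/

/-- Under `hshell` the scaled lattice is `e⁻¹(Π_{v⃗} c(v⃗)·(R_{v⃗})^∼)` (abc-iut-c312-5's `latticePkS_eq_of_unramified`, re-threaded).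
[cite: Mochizuki2012, IUTchIV Thm 1.10 proof Step (vi) p. 29] -/
theorem latticePkS_eq_of_shell (hshell : ∀ e : T.Caps j → T.Fibre vQ, logShell p (P.kk e) = (normalizedPacket p (P.kk e) : Set (P.X e)))
    (c : (T.Caps j → T.Fibre vQ) → ℚ_[p]) :
    P.latticePkS j c =
      P.comparison j ⁻¹' Set.pi univ fun e => c e • (normalizedPacket p (P.kk e) : Set (P.X e)) := by
  unfold latticePkS summandLatticeS
  congr 2
  funext e
  rw [hshell e]

/-- Under `hshell` the scaled lattice (all `c(v⃗) ≠ 0`) IS the field-factor preimage of the hull-set with block-constant centre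
`(c(v⃗))_{(v⃗,i)}` (abc-iut-c312-5's `latticePkS_eq_preimage_hullSet_of_unramified`, re-threaded). [cite: Mochizuki2012, IUTchIII Rmk. 3.9.5 (ii) p. 127] -/
theorem latticePkS_eq_preimage_hullSet_of_shell
    (hshell : ∀ e : T.Caps j → T.Fibre vQ, logShell p (P.kk e) = (normalizedPacket p (P.kk e) : Set (P.X e)))
    {c : (T.Caps j → T.Fibre vQ) → ℚ_[p]} (hc : ∀ e, c e ≠ 0) :
    P.latticePkS j c = (fun x => P.factorMap j x) ⁻¹'
      hullSet (P.factorField j) (P.centreOf fun e => algebraMap ℚ_[p] (P.X e) (c e)) := by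
  haveI : Nonempty (T.Caps j) := ⟨0⟩
  rw [P.factorMap_preimage_hullSet_centreOf _ fun e i => dEquiv_algebraMap_ne_zero p (P.kk e) (hc e) i,
    P.latticePkS_eq_of_shell hshell c]
  congr 2
  funext e
  exact smul_set_eq_algebraMap_smul p (P.kk e) (c e) _

/-- … and its image under the (onto) field-factor comparison IS that hull-set (abc-iut-c312-5's
`image_factorMap_latticePkS_of_unramified`, re-threaded). [cite: Mochizuki2012, IUTchIII Rmk. 3.9.5 (ii) p. 127] -/
theorem image_factorMap_latticePkS_of_shell
    (hshell : ∀ e : T.Caps j → T.Fibre vQ, logShell p (P.kk e) = (normalizedPacket p (P.kk e) : Set (P.X e)))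
    {c : (T.Caps j → T.Fibre vQ) → ℚ_[p]} (hc : ∀ e, c e ≠ 0) :
    (fun x => P.factorMap j x) '' P.latticePkS j c =
      hullSet (P.factorField j) (P.centreOf fun e => algebraMap ℚ_[p] (P.X e) (c e)) := by
  rw [P.latticePkS_eq_preimage_hullSet_of_shell hshell hc]
  exact Set.image_preimage_eq _ (P.factorMap_surjective j)

end Cor312Vol.PadicPresentation

namespace Thm311.Real

open Cor312 Cor312Vol Literature.IUT.LogThetaLattice Literature.IUT.LogVolume

variable {F : Type} [Field F] [NumberField F] (X : PilotData F) {logv : PadicLogs F} (hlog : LogvAnalytic logv)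

/-! ## §2. At `Real.settingDHVol` with summand-wise scaled DH boxes, under `hshell` -/

section Boxes

variable (B : ∀ (pp : Nat.Primes) (j : (thetaIndex X).Label)
    (e : (thetaIndex X).Caps j → (thetaIndex X).Fibre (.inr pp)),
    haveI : Fact (pp : ℕ).Prime := ⟨pp.2⟩; Set ((presAt X hlog pp).X e))
  (M : Type) [Field M] [NumberField M]
  (archPk : ∀ (j : (thetaIndex X).Label) (vQ : (thetaIndex X).VQ), Set ((logShellsDH X logv).Packet j vQ))
  (archSub : ∀ (j : (thetaIndex X).Label) (v : (thetaIndex X).V),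
    Set ((logShellsDH X logv).Packet j ((thetaIndex X).over v)))
  (Ψ : ℤ → ∀ v : (thetaIndex X).V, v ∈ (thetaIndex X).Vbad → Set ((logShellsDH X logv).StarPacket v))
  (act : ℤ → ∀ v : (thetaIndex X).V, v ∈ (thetaIndex X).Vbad →
    (logShellsDH X logv).StarPacket v → Module.End ℚ ((logShellsDH X logv).StarPacket v))
  (Mmod : ℤ → ∀ j : (thetaIndex X).LabelStar, Set ((logShellsDH X logv).GlobalPacket j.1))
  (region : ℤ → ∀ j : (thetaIndex X).LabelStar, FinDivisor M → ∀ vQ : (thetaIndex X).VQ,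
    Set ((logShellsDH X logv).Packet j.1 vQ))
  (n : ℤ) {HT : Type} {LogLink : HT → HT → Type} {IsFull : ∀ {s t : HT}, LogLink s t → Prop}
  (lat : LGPGaussianLogThetaLattice LogLink IsFull)
  {Frd : Type} {IsoF : Frd → Frd → Type} {Ob : Frd → Type} {realify : Frd → Frd} {Strip : Type}
  {IsoS : Strip → Strip → Type} {Mv : ∀ v : (thetaIndex X).V, v ∈ (thetaIndex X).Vbad → Type}
  [∀ v h, Monoid (Mv v h)]
  (sig : GlobalLGPFrobenioidSignature (thetaIndex X).lstar (thetaIndex X).V (· ∈ (thetaIndex X).Vbad)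
    Frd IsoF Ob realify Strip IsoS Mv)
  (split : SplittingMonoids Mv) {ObΔ : Type} {N : ∀ v : (thetaIndex X).V, v ∈ (thetaIndex X).Vbad → Type}
  [∀ v h, Monoid (N v h)] (qData : QPilotData ObΔ N)
  (qCentre : ObΔ → ∀ (j : (thetaIndex X).Label) (vQ : (thetaIndex X).VQ),
    ∀ s : factorIdxDH X hlog j vQ, factorFieldDH X hlog j vQ s)
  (hq : ∀ j vQ s, qCentre (qPilotObject qData) j vQ s ≠ 0)
  (hfin : ∀ j : (thetaIndex X).Label, (Function.support fun vQ =>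
    ((situationDHVol X hlog M archPk archSub Ψ act Mmod region).D n).logvol j vQ
      (factorMapDH X hlog j vQ ⁻¹' hullSet (factorFieldDH X hlog j vQ) (qCentre (qPilotObject qData) j vQ))).Finite)

/-- Under `hshell`, the (Ind3)-region of the setting with DH boxes `B_{p,j,v⃗} = c(v⃗)·(R_{v⃗})^∼` IS the scaled lattice
`e⁻¹(Π_{v⃗} c(v⃗)·I_{v⃗})` (abc-iut-c312-5's `thetaRegion3_eq_latticePkS`, re-threaded). [cite: DupuyHilado2025, §3.9, §4.10] -/
theorem thetaRegion3_eq_latticePkS_of_shell (i : Fin (thetaIndex X).lstar) (pp : Nat.Primes) [Fact (pp : ℕ).Prime]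
    (hshell : ∀ e : (thetaIndex X).Caps (Setting.labelSucc i) → (thetaIndex X).Fibre (.inr pp),
      logShell (pp : ℕ) ((presAt X hlog pp).kk e) = (normalizedPacket (pp : ℕ) ((presAt X hlog pp).kk e) : Set ((presAt X hlog pp).X e)))
    (c : ((thetaIndex X).Caps (Setting.labelSucc i) → (thetaIndex X).Fibre (.inr pp)) → ℚ_[pp])
    (hB : ∀ e, B pp (Setting.labelSucc i) e =
      c e • (normalizedPacket (pp : ℕ) ((presAt X hlog pp).kk e) : Set ((presAt X hlog pp).X e))) :
    (settingDHVol X hlog M archPk archSub Ψ act Mmod region n lat sig split qData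
        (fun _ _ => thetaBoxDH X hlog B) qCentre hq hfin).thetaRegion3 (Setting.labelSucc i) (.inr pp) =
      (presAt X hlog pp).latticePkS (Setting.labelSucc i) c := by
  rw [thetaRegion3_thetaBoxDH, (presAt X hlog pp).latticePkS_eq_of_shell hshell c]
  show (fun x => (presAt X hlog pp).factorMap _ x) ⁻¹' (presAt X hlog pp).boxOf (B pp (Setting.labelSucc i)) = _
  rw [(presAt X hlog pp).factorMap_preimage_boxOf]
  congr 1
  exact Set.pi_congr rfl fun e _ => hB e

/-- Under `hshell`, the union of ALL possible images at that packet is the union over the capsule permutations `σ` of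
`e⁻¹(Π_{v⃗} c(v⃗∘σ)·I_{v⃗})` (abc-iut-c312-5's `sUnion_possibleImages_eq`, re-threaded). [cite: DupuyHilado2025, §4.7, §4.9] -/
theorem sUnion_possibleImages_eq_of_shell (i : Fin (thetaIndex X).lstar) (pp : Nat.Primes) [Fact (pp : ℕ).Prime]
    (hshell : ∀ e : (thetaIndex X).Caps (Setting.labelSucc i) → (thetaIndex X).Fibre (.inr pp),
      logShell (pp : ℕ) ((presAt X hlog pp).kk e) = (normalizedPacket (pp : ℕ) ((presAt X hlog pp).kk e) : Set ((presAt X hlog pp).X e)))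
    (c : ((thetaIndex X).Caps (Setting.labelSucc i) → (thetaIndex X).Fibre (.inr pp)) → ℚ_[pp])
    (hB : ∀ e, B pp (Setting.labelSucc i) e =
      c e • (normalizedPacket (pp : ℕ) ((presAt X hlog pp).kk e) : Set ((presAt X hlog pp).X e))) :
    ⋃₀ (settingDHVol X hlog M archPk archSub Ψ act Mmod region n lat sig split qData
        (fun _ _ => thetaBoxDH X hlog B) qCentre hq hfin).possibleImages (Setting.labelSucc i) (.inr pp) =
      ⋃ σ : Equiv.Perm ((thetaIndex X).Caps (Setting.labelSucc i)),
        (presAt X hlog pp).latticePkS (Setting.labelSucc i) (fun e => c (e ∘ ⇑σ)) := by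
  unfold Setting.possibleImages
  rw [thetaRegion3_eq_latticePkS_of_shell X hlog B M archPk archSub Ψ act Mmod region n lat sig split qData qCentre hq hfin i
    pp hshell c hB]
  exact (presAt X hlog pp).sUnion_orbit_latticePkS c

/-- Under `hshell`, the image under the field-factor comparison of that union is the union of the hull-sets with
block-constant centres `(c(v⃗∘σ))` (abc-iut-c312-5's `image_sUnion_possibleImages_eq`, re-threaded).
[cite: Mochizuki2012, IUTchIII Rmk. 3.9.5 (ii) p. 127] -/
theorem image_sUnion_possibleImages_eq_of_shell (i : Fin (thetaIndex X).lstar) (pp : Nat.Primes) [Fact (pp : ℕ).Prime]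
    (hshell : ∀ e : (thetaIndex X).Caps (Setting.labelSucc i) → (thetaIndex X).Fibre (.inr pp),
      logShell (pp : ℕ) ((presAt X hlog pp).kk e) = (normalizedPacket (pp : ℕ) ((presAt X hlog pp).kk e) : Set ((presAt X hlog pp).X e)))
    (c : ((thetaIndex X).Caps (Setting.labelSucc i) → (thetaIndex X).Fibre (.inr pp)) → ℚ_[pp])
    (hc : ∀ e, c e ≠ 0)
    (hB : ∀ e, B pp (Setting.labelSucc i) e =
      c e • (normalizedPacket (pp : ℕ) ((presAt X hlog pp).kk e) : Set ((presAt X hlog pp).X e))) :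
    factorMapDH X hlog (Setting.labelSucc i) (.inr pp) ''
        ⋃₀ (settingDHVol X hlog M archPk archSub Ψ act Mmod region n lat sig split qData
          (fun _ _ => thetaBoxDH X hlog B) qCentre hq hfin).possibleImages (Setting.labelSucc i) (.inr pp) =
      ⋃ σ : Equiv.Perm ((thetaIndex X).Caps (Setting.labelSucc i)),
        hullSet (factorFieldDH X hlog (Setting.labelSucc i) (.inr pp))
          ((presAt X hlog pp).centreOf fun e => algebraMap ℚ_[pp] ((presAt X hlog pp).X e) (c (e ∘ ⇑σ))) := by
  refine (congrArg (Set.image (factorMapDH X hlog (Setting.labelSucc i) (.inr pp)))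
    (sUnion_possibleImages_eq_of_shell X hlog B M archPk archSub Ψ act Mmod region n lat sig split qData qCentre hq hfin i pp
      hshell c hB)).trans ?_
  rw [Set.image_iUnion]
  refine Set.iUnion_congr fun σ => ?_
  exact (presAt X hlog pp).image_factorMap_latticePkS_of_shell hshell fun e => hc _

/-- **Under `hshell`, `^{n,∘}𝒰_{i+1,p} = e⁻¹(Π_{v⃗} ĉ(v⃗)·I_{v⃗})`** for ANY capsule-symmetric majorant `ĉ` attained on the
capsule orbit (abc-iut-c312-5's `thetaHull_eq_latticePkS`, re-threaded). [cite: Mochizuki2012, IUTchIV Thm 1.10 proof Step (vi) p. 29] -/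
theorem thetaHull_eq_latticePkS_of_shell (i : Fin (thetaIndex X).lstar) (pp : Nat.Primes) [Fact (pp : ℕ).Prime]
    (hshell : ∀ e : (thetaIndex X).Caps (Setting.labelSucc i) → (thetaIndex X).Fibre (.inr pp),
      logShell (pp : ℕ) ((presAt X hlog pp).kk e) = (normalizedPacket (pp : ℕ) ((presAt X hlog pp).kk e) : Set ((presAt X hlog pp).X e)))
    (c : ((thetaIndex X).Caps (Setting.labelSucc i) → (thetaIndex X).Fibre (.inr pp)) → ℚ_[pp])
    (hc : ∀ e, c e ≠ 0)
    (hB : ∀ e, B pp (Setting.labelSucc i) e =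
      c e • (normalizedPacket (pp : ℕ) ((presAt X hlog pp).kk e) : Set ((presAt X hlog pp).X e)))
    (ĉ : ((thetaIndex X).Caps (Setting.labelSucc i) → (thetaIndex X).Fibre (.inr pp)) → ℚ_[pp])
    (hĉ0 : ∀ e, ĉ e ≠ 0) (hle : ∀ (σ : Equiv.Perm _) e, ‖c (e ∘ ⇑σ)‖ ≤ ‖ĉ e‖)
    (hatt : ∀ e, ∃ σ : Equiv.Perm _, ‖c (e ∘ ⇑σ)‖ = ‖ĉ e‖) :
    (settingDHVol X hlog M archPk archSub Ψ act Mmod region n lat sig split qData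
        (fun _ _ => thetaBoxDH X hlog B) qCentre hq hfin).thetaHull (Setting.labelSucc i) (.inr pp) =
      (presAt X hlog pp).latticePkS (Setting.labelSucc i) ĉ := by
  haveI hF : Fintype ((presAt X hlog pp).factorIdx (Setting.labelSucc i)) :=
    factorIdxDH_fintype X hlog (Setting.labelSucc i) (.inr pp)
  have hfU := image_sUnion_possibleImages_eq_of_shell X hlog B M archPk archSub Ψ act Mmod region n lat sig split qData qCentre
    hq hfin i pp hshell c hc hB
  have hb : Bornology.IsBounded (factorMapDH X hlog (Setting.labelSucc i) (.inr pp) ''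
      ⋃₀ (settingDHVol X hlog M archPk archSub Ψ act Mmod region n lat sig split qData
          (fun _ _ => thetaBoxDH X hlog B) qCentre hq hfin).possibleImages (Setting.labelSucc i) (.inr pp)) := by
    rw [hfU]
    exact (presAt X hlog pp).isBounded_iUnion_hullSet_centreOf (fun (σ : Equiv.Perm _) e => c (e ∘ ⇑σ)) hle
  have hnd : IsNondegenerate (factorFieldDH X hlog (Setting.labelSucc i) (.inr pp))
      (factorMapDH X hlog (Setting.labelSucc i) (.inr pp) ''
        ⋃₀ (settingDHVol X hlog M archPk archSub Ψ act Mmod region n lat sig split qData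
          (fun _ _ => thetaBoxDH X hlog B) qCentre hq hfin).possibleImages (Setting.labelSucc i) (.inr pp)) := by
    rw [hfU]
    exact (presAt X hlog pp).isNondegenerate_iUnion_hullSet_centreOf (fun (σ : Equiv.Perm _) e => c (e ∘ ⇑σ))
      fun σ e => hc _
  show ((HullFrame.ofLocalFields (factorFieldDH X hlog (Setting.labelSucc i) (.inr pp))).comap
      (factorMapDH X hlog (Setting.labelSucc i) (.inr pp))).hull
      (⋃₀ (settingDHVol X hlog M archPk archSub Ψ act Mmod region n lat sig split qData
          (fun _ _ => thetaBoxDH X hlog B) qCentre hq hfin).possibleImages (Setting.labelSucc i) (.inr pp)) = _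
  rw [HullFrame.comap_hull _ _ hb, HullFrame.ofLocalFields_hull_eq _ hb hnd, hfU]
  show factorMapDH X hlog (Setting.labelSucc i) (.inr pp) ⁻¹'
      holomorphicHull ((presAt X hlog pp).factorField (Setting.labelSucc i))
        (⋃ σ : Equiv.Perm ((thetaIndex X).Caps (Setting.labelSucc i)),
          hullSet ((presAt X hlog pp).factorField (Setting.labelSucc i))
            ((presAt X hlog pp).centreOf fun e => algebraMap ℚ_[pp] ((presAt X hlog pp).X e) (c (e ∘ ⇑σ)))) = _
  rw [(presAt X hlog pp).holomorphicHull_iUnion_hullSet_centreOf (fun (σ : Equiv.Perm _) e => c (e ∘ ⇑σ)) hĉ0 hle hatt]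
  exact ((presAt X hlog pp).latticePkS_eq_preimage_hullSet_of_shell hshell hĉ0).symm

end Boxes

/-! ## §3. The sharp settings of record with Θ-exponents `m` over `p`, under `hshell` -/

section Sharp

variable (t : ∀ (pp : Nat.Primes) (_ : Fin X.lstar) (x : (thetaIndex X).Fibre (.inr pp)),
    haveI : Fact (pp : ℕ).Prime := ⟨pp.2⟩; kOf X pp.1 x)
  (tq : ∀ (pp : Nat.Primes) (x : (thetaIndex X).Fibre (.inr pp)),
    haveI : Fact (pp : ℕ).Prime := ⟨pp.2⟩; kOf X pp.1 x)
  (M : Type) [Field M] [NumberField M]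
  (archPk : ∀ (j : (thetaIndex X).Label) (vQ : (thetaIndex X).VQ), Set ((logShellsDH X logv).Packet j vQ))
  (archSub : ∀ (j : (thetaIndex X).Label) (v : (thetaIndex X).V),
    Set ((logShellsDH X logv).Packet j ((thetaIndex X).over v)))
  (Ψ : ℤ → ∀ v : (thetaIndex X).V, v ∈ (thetaIndex X).Vbad → Set ((logShellsDH X logv).StarPacket v))
  (act : ℤ → ∀ v : (thetaIndex X).V, v ∈ (thetaIndex X).Vbad →
    (logShellsDH X logv).StarPacket v → Module.End ℚ ((logShellsDH X logv).StarPacket v))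
  (Mmod : ℤ → ∀ j : (thetaIndex X).LabelStar, Set ((logShellsDH X logv).GlobalPacket j.1))
  (region : ℤ → ∀ j : (thetaIndex X).LabelStar, FinDivisor M → ∀ vQ : (thetaIndex X).VQ,
    Set ((logShellsDH X logv).Packet j.1 vQ))
  (n : ℤ) {HT : Type} {LogLink : HT → HT → Type} {IsFull : ∀ {s t : HT}, LogLink s t → Prop}
  (lat : LGPGaussianLogThetaLattice LogLink IsFull)
  {Frd : Type} {IsoF : Frd → Frd → Type} {Ob : Frd → Type} {realify : Frd → Frd} {Strip : Type}
  {IsoS : Strip → Strip → Type} {Mv : ∀ v : (thetaIndex X).V, v ∈ (thetaIndex X).Vbad → Type}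
  [∀ v h, Monoid (Mv v h)]
  (sig : GlobalLGPFrobenioidSignature (thetaIndex X).lstar (thetaIndex X).V (· ∈ (thetaIndex X).Vbad)
    Frd IsoF Ob realify Strip IsoS Mv)
  (split : SplittingMonoids Mv) {ObΔ : Type} {N : ∀ v : (thetaIndex X).V, v ∈ (thetaIndex X).Vbad → Type}
  [∀ v h, Monoid (N v h)] (qData : QPilotData ObΔ N)

/-- **Under `hshell`, at the sharp DH setting of record with Θ-exponents `‖t_{Θ,i+1,v}‖ = ‖p^{m(v)}‖` over `p`:
`^{n,∘}𝒰_{i+1,p} = e⁻¹(Π_{v⃗} p^{min_a m(v_a)}·I_{v⃗})`** (abc-iut-c312-5's `thetaHull_settingDHVolSharp_eq_of_zpow`, re-threaded).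
[cite: DupuyHilado2025, §3.9, §4.7] -/
theorem thetaHull_settingDHVolSharp_eq_of_zpow_of_shell (ht0 : ∀ pp i x, t pp i x ≠ 0) (htq0 : ∀ pp x, tq pp x ≠ 0)
    (htq1 : ∀ (pp : Nat.Primes) (x : (thetaIndex X).Fibre (.inr pp)),
      haveI : Fact (pp : ℕ).Prime := ⟨pp.2⟩; placeOf X pp.1 x ∉ X.S → ‖tq pp x‖ = 1)
    (i : Fin (thetaIndex X).lstar) (pp : Nat.Primes) [Fact (pp : ℕ).Prime]
    (hshell : ∀ e : (thetaIndex X).Caps (Setting.labelSucc i) → (thetaIndex X).Fibre (.inr pp),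
      logShell (pp : ℕ) ((presAt X hlog pp).kk e) = (normalizedPacket (pp : ℕ) ((presAt X hlog pp).kk e) : Set ((presAt X hlog pp).X e)))
    (m : (thetaIndex X).Fibre (.inr pp) → ℤ) (hm : ∀ x, ‖t pp i x‖ = ‖((pp : ℕ) : ℚ_[pp]) ^ m x‖) :
    (settingDHVolSharp X hlog M archPk archSub Ψ act Mmod region n lat sig split qData tq t htq0
        htq1).thetaHull (Setting.labelSucc i) (.inr pp) =
      (presAt X hlog pp).latticePkS (Setting.labelSucc i) fun e =>
        ((pp : ℕ) : ℚ_[pp]) ^ Finset.univ.inf' Finset.univ_nonempty (fun a => m (e a)) := by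
  haveI : Nonempty ((thetaIndex X).Caps (Setting.labelSucc i)) := ⟨0⟩
  have hpQ : ((pp : ℕ) : ℚ_[pp]) ≠ 0 := Nat.cast_ne_zero.mpr pp.2.ne_zero
  have hp1 : 1 < ((pp : ℕ) : ℝ) := by exact_mod_cast pp.2.one_lt
  have hnorm : ∀ a b : ℤ, ‖((pp : ℕ) : ℚ_[pp]) ^ a‖ ≤ ‖((pp : ℕ) : ℚ_[pp]) ^ b‖ ↔ b ≤ a := by
    intro a b
    rw [norm_zpow, norm_zpow, Padic.norm_p, inv_zpow', inv_zpow', zpow_le_zpow_iff_right₀ hp1, neg_le_neg_iff]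
  refine thetaHull_eq_latticePkS_of_shell X hlog _ M archPk archSub Ψ act Mmod region n lat sig split qData _ _ _ i pp hshell
    (fun e => ((pp : ℕ) : ℚ_[pp]) ^ m (e (Fin.last _))) (fun e => zpow_ne_zero _ hpQ) (fun e => ?_) _
    (fun e => zpow_ne_zero _ hpQ) (fun σ e => ?_) (fun e => ?_)
  · -- the sharp box at `(i+1, p, v⃗)` is `p^{m(v_{i+1})}·(R_{v⃗})^∼`
    show sharpBoxDH X hlog t pp (Setting.labelSucc i) e = _
    unfold sharpBoxDH
    rw [labelIdele_labelSucc]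
    exact (presAt X hlog pp).iota_smul_normalizedPacket_eq_smul e (Fin.last _) (ht0 pp i _) (hm _)
  · -- `‖p^{m(v_{σ(i+1)})}‖ ≤ ‖p^{min_a m(v_a)}‖`
    rw [hnorm]
    exact Finset.inf'_le (fun a => m (e a)) (Finset.mem_univ (σ (Fin.last _)))
  · -- the minimum is attained: swap the last coordinate with a minimising one
    obtain ⟨a₀, -, ha₀⟩ := Finset.exists_min_image Finset.univ (fun a => m (e a)) Finset.univ_nonempty
    refine ⟨Equiv.swap (Fin.last _) a₀, ?_⟩
    have hmin : Finset.univ.inf' Finset.univ_nonempty (fun a => m (e a)) = m (e a₀) :=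
      le_antisymm (Finset.inf'_le _ (Finset.mem_univ a₀)) (Finset.le_inf' _ _ fun a _ => ha₀ a (Finset.mem_univ a))
    show ‖((pp : ℕ) : ℚ_[pp]) ^ m (e (Equiv.swap (Fin.last _) a₀ (Fin.last _)))‖ = _
    rw [Equiv.swap_apply_left, hmin]

/-- The same at the PRINT-NORMALISED sharp setting of record (the set-level objects coincide, abc-iut-c312-5's
`thetaHull_settingPrVolSharp_eq_settingDHVolSharp`). [cite: DupuyHilado2025, §3.9, §4.7] -/
theorem thetaHull_settingPrVolSharp_eq_of_zpow_of_shell (ht0 : ∀ pp i x, t pp i x ≠ 0) (htq0 : ∀ pp x, tq pp x ≠ 0)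
    (htq1 : ∀ (pp : Nat.Primes) (x : (thetaIndex X).Fibre (.inr pp)),
      haveI : Fact (pp : ℕ).Prime := ⟨pp.2⟩; placeOf X pp.1 x ∉ X.S → ‖tq pp x‖ = 1)
    (i : Fin (thetaIndex X).lstar) (pp : Nat.Primes) [Fact (pp : ℕ).Prime]
    (hshell : ∀ e : (thetaIndex X).Caps (Setting.labelSucc i) → (thetaIndex X).Fibre (.inr pp),
      logShell (pp : ℕ) ((presAt X hlog pp).kk e) = (normalizedPacket (pp : ℕ) ((presAt X hlog pp).kk e) : Set ((presAt X hlog pp).X e)))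
    (m : (thetaIndex X).Fibre (.inr pp) → ℤ) (hm : ∀ x, ‖t pp i x‖ = ‖((pp : ℕ) : ℚ_[pp]) ^ m x‖) :
    (settingPrVolSharp X hlog M archPk archSub Ψ act Mmod region n lat sig split qData tq t htq0
        htq1).thetaHull (Setting.labelSucc i) (.inr pp) =
      (presAt X hlog pp).latticePkS (Setting.labelSucc i) fun e =>
        ((pp : ℕ) : ℚ_[pp]) ^ Finset.univ.inf' Finset.univ_nonempty (fun a => m (e a)) := by
  rw [thetaHull_settingPrVolSharp_eq_settingDHVolSharp]
  exact thetaHull_settingDHVolSharp_eq_of_zpow_of_shell X hlog t tq M archPk archSub Ψ act Mmod region n lat sig split qData ht0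
    htq0 htq1 i pp hshell m hm

/-- **Under `hshell`, the print-normalised log-volume of a `p`-power scaled lattice**: `μ^log_{Pr}(e⁻¹(Π_{v⃗} p^{k(v⃗)}·I_{v⃗}))
= Σ_{v⃗} Pr(v⃗)·(−k(v⃗)·log p)` (abc-iut-c312-5's `logvol_latticePkS_ppow_settingPrVol`, re-threaded).
[cite: DupuyHilado2025, §3.6, Rmk. 3.5.4] -/
theorem logvol_latticePkS_ppow_settingPrVol_of_shell (i : Fin (thetaIndex X).lstar) (pp : Nat.Primes) [Fact (pp : ℕ).Prime]
    (hshell : ∀ e : (thetaIndex X).Caps (Setting.labelSucc i) → (thetaIndex X).Fibre (.inr pp),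
      logShell (pp : ℕ) ((presAt X hlog pp).kk e) = (normalizedPacket (pp : ℕ) ((presAt X hlog pp).kk e) : Set ((presAt X hlog pp).X e)))
    (k : ((thetaIndex X).Caps (Setting.labelSucc i) → (thetaIndex X).Fibre (.inr pp)) → ℤ) :
    ((situationPrVol X hlog M archPk archSub Ψ act Mmod region).D n).logvol (Setting.labelSucc i) (.inr pp)
        ((presAt X hlog pp).latticePkS (Setting.labelSucc i) fun e => ((pp : ℕ) : ℚ_[pp]) ^ k e) =
      ∑ e : (presAt X hlog pp).toLocalPieces.E (Setting.labelSucc i),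
        weightPr X pp.1 (Setting.labelSucc i) e * (-(k e * Real.log (pp : ℕ))) := by
  rw [(presAt X hlog pp).latticePkS_eq_of_shell hshell]
  have hadm : ∀ e : (thetaIndex X).Caps (Setting.labelSucc i) → (thetaIndex X).Fibre (.inr pp),
      PacketAdm (pp : ℕ) ((presAt X hlog pp).kk e)
        ((((pp : ℕ) : ℚ_[pp]) ^ k e) • (normalizedPacket (pp : ℕ) ((presAt X hlog pp).kk e) :
          Set ((presAt X hlog pp).X e))) :=
    fun e => packetAdm_const_smul (pp : ℕ) _ (zpow_ne_zero _ (Nat.cast_ne_zero.mpr pp.2.ne_zero))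
      (packetAdm_normalizedPacket (pp : ℕ) _)
  have key := SummandPieces.logvol_preimage_pi (summandPiecesPr X hlog) (Setting.labelSucc i) (.inr pp)
    (R := fun e => (((pp : ℕ) : ℚ_[pp]) ^ k e) • (normalizedPacket (pp : ℕ) ((presAt X hlog pp).kk e) :
      Set ((presAt X hlog pp).X e))) hadm
  refine (((realizes_situationPrVol X hlog M archPk archSub Ψ act Mmod region n).logvol_eq _ (.inr pp) _).trans
    key).trans (Finset.sum_congr rfl fun e _ => ?_)
  haveI : Nonempty ((thetaIndex X).Caps (Setting.labelSucc i)) := ⟨0⟩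
  show weightPr X pp.1 (Setting.labelSucc i) e * packetLogμ (pp : ℕ) ((presAt X hlog pp).kk e) _ = _
  congr 1
  rw [smul_set_eq_algebraMap_smul (pp : ℕ) ((presAt X hlog pp).kk e)]
  show packetLogμ (pp : ℕ) ((presAt X hlog pp).kk e)
    (ppow (pp : ℕ) ((presAt X hlog pp).kk e) (k e) • (normalizedPacket (pp : ℕ) ((presAt X hlog pp).kk e) :
      Set ((presAt X hlog pp).X e))) = _
  rw [packetLogμ_ppow_smul (pp : ℕ) _ (k e) (packetAdm_normalizedPacket (pp : ℕ) _), packetLogμ_normalizedPacket,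
    add_zero]

/-- **Under `hshell`, the local Θ-volume of the print-normalised sharp setting of record in closed form**:
`−|log(Θ)|_{i+1,p} = Σ_{v⃗} Pr(v⃗)·(−min_a m(v⃗ a)·log p)` when `‖t_{Θ,i+1,v}‖ = ‖p^{m(v)}‖` over `p` and the Θ-ideles are
non-zero units off `S` (abc-iut-c312-5's `thetaLocal_settingPrVolSharp_eq_of_zpow`, re-threaded; `HullDefined` from
`ThetaFinite`). [cite: DupuyHilado2025, §3.6, §3.9, Rmk. 3.5.4] -/
theorem thetaLocal_settingPrVolSharp_eq_of_zpow_of_shell (ht0 : ∀ pp i x, t pp i x ≠ 0)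
    (ht1 : ∀ (pp : Nat.Primes) (i : Fin X.lstar) (x : (thetaIndex X).Fibre (.inr pp)),
      haveI : Fact (pp : ℕ).Prime := ⟨pp.2⟩; placeOf X pp.1 x ∉ X.S → ‖t pp i x‖ = 1)
    (htq0 : ∀ pp x, tq pp x ≠ 0)
    (htq1 : ∀ (pp : Nat.Primes) (x : (thetaIndex X).Fibre (.inr pp)),
      haveI : Fact (pp : ℕ).Prime := ⟨pp.2⟩; placeOf X pp.1 x ∉ X.S → ‖tq pp x‖ = 1)
    (i : Fin (thetaIndex X).lstar) (pp : Nat.Primes) [Fact (pp : ℕ).Prime]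
    (hshell : ∀ e : (thetaIndex X).Caps (Setting.labelSucc i) → (thetaIndex X).Fibre (.inr pp),
      logShell (pp : ℕ) ((presAt X hlog pp).kk e) = (normalizedPacket (pp : ℕ) ((presAt X hlog pp).kk e) : Set ((presAt X hlog pp).X e)))
    (m : (thetaIndex X).Fibre (.inr pp) → ℤ) (hm : ∀ x, ‖t pp i x‖ = ‖((pp : ℕ) : ℚ_[pp]) ^ m x‖) :
    (settingPrVolSharp X hlog M archPk archSub Ψ act Mmod region n lat sig split qData tq t htq0
        htq1).thetaLocal (Setting.labelSucc i) (.inr pp) =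
      ((∑ e : (presAt X hlog pp).toLocalPieces.E (Setting.labelSucc i),
        weightPr X pp.1 (Setting.labelSucc i) e *
          (-(Finset.univ.inf' Finset.univ_nonempty (fun a => m (e a)) * Real.log (pp : ℕ))) : ℝ) : WithTop ℝ) := by
  haveI : Nonempty ((thetaIndex X).Caps (Setting.labelSucc i)) := ⟨0⟩
  have hHD : (settingPrVolSharp X hlog M archPk archSub Ψ act Mmod region n lat sig split qData tq t htq0
      htq1).HullDefined (Setting.labelSucc i) (.inr pp) := by
    have h := (thetaFinite_settingPrVolSharp X hlog M archPk archSub Ψ act Mmod region n lat sig split qData t tq ht0 ht1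
      htq0 htq1).1 i (.inr pp)
    by_contra hnd
    apply h
    unfold Setting.thetaLocal
    rw [if_neg hnd]
  unfold Setting.thetaLocal
  rw [if_pos hHD, thetaHull_settingPrVolSharp_eq_of_zpow_of_shell X hlog t tq M archPk archSub Ψ act Mmod region n lat sig split
    qData ht0 htq0 htq1 i pp hshell m hm]
  congr 1
  have h := logvol_latticePkS_ppow_settingPrVol_of_shell X hlog M archPk archSub Ψ act Mmod region n i pp hshell
    fun e => Finset.univ.inf' Finset.univ_nonempty fun a => m (e a)
  rw [settingPrVolSharp_n]
  exact h

end Sharp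

end Thm311.Real

end Summit.ABC.IUTFork

end
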